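import Summits.Ventures.YMGap.FlowData.TubePolyakovLine
import Summits.Ventures.YMGap.FlowData.RectTubeTransferPositivity
import Literature.Analysis.OperatorTheory.SlabFibreContraction
import HarnessLib

/-!
# Venture YMGap, track Y3 FLOW-DATA (v2, rectangular cross-sections `Π_i ℤ/(Ls i)`) — the temporal-link integral
# of the rectangular slice kernel against a GAUGE-INVARIANT function, and its value on a POLYAKOV LINE (theorems only)

HONEST FRAMING: venture file of the cell `pub-ymgap` (QuantumFields programme), track Y3; the `L₁ × L₂` twin of
`FlowData/TubePolyakovLine.lean` for the v2 objects of `FlowData/RectSliceKernel.lean` /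
`RectTubeTransferOperator.lean` (the table's `2×3`, `2×4` tubes), preparing `FlowData/RectTubeFluxNonAnnihilation.lean`.
Finite-dimensional Haar integrals on a finite rectangular torus; no number, no row, nothing about limits or a mass
gap.  Gauge transformations of a rectangular slice are written out link by link,
`b ↦ (e ↦ γ(e.1) b(e) γ(e.1 + ê_{e.2})⁻¹)` (as in `RectTubeTransferPositivity.rectElecSum_gauge_div`).

* `rectMagSum_gauge`, `rectElecSum_gauge_right` — gauge covariance of the rectangular plaquette sums (the slice
  measure is gauge invariant: `RectTubeTransferPositivity.measurePreserving_rectGauge`);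
* `integral_integral_exp_rectElecSum_mul` — `∫ (∫ e^{J elec(a,E,b)} dE) F(b) db = ∫ (∏_e w(c_e)) F(c·a) dc` for a
  continuous gauge-invariant `F`, `w = e^{J Re tr ρ}` (the temporal links gauge away);
* `prod_ofFn_rectLine_gauge`, `prod_ofFn_rectLine_fluxTwist` — the straight Polyakov line `t ↦ (t ê_μ, μ)`,
  `t < Ls μ`, is conjugated by a gauge transformation and picks up exactly one `z` under a twist `s` with `s_μ = 1`;
* **`integral_prod_weight_mul_re_trace_rectLine`** — window lemma + Haar chain:
  `∫ (∏_e w(c_e)) Re tr(A ρ(∏ₜ c_{ℓ t} aₜ) B) dc = c₀^{N−m} λ^m Re tr(A ρ(∏ₜ aₜ) B)` for any injective `ℓ`.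

References: I. Montvay, G. Münster (1994) §3.2.6 [cite: MontvayMunster1994, §3.2.6]; G. 't Hooft, Nucl. Phys. B 153
(1979) 141 [cite: tHooft1979Flux].
-/

noncomputable section

open scoped BigOperators
open MeasureTheory Filter Function
open Literature.MathematicalPhysics.QuantumFieldTheory Literature.Analysis.OperatorTheory
open Literature.MathematicalPhysics.QuantumLattice (RectTorusSite)

namespace Summit.Ventures.YMGap.FlowData

/-! ### Gauge covariance on the rectangular slice -/

section Gauge

variable {G : Type*} [Group G] {n k : ℕ} (ρ : G →* Matrix (Fin n) (Fin n) ℂ) {Ls : Fin k → ℕ} [∀ i, NeZero (Ls i)]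

/-- **Spatial plaquettes are gauge invariant** on the rectangular slice (the holonomy is conjugated by `γ(x)`).
[folklore] -/
theorem rectMagSum_gauge (γ : RectTorusSite Ls → G) (b : RectSlice Ls G) :
    rectMagSum (Ls := Ls) ρ (fun e => γ e.1 * b e * (γ (e.1 + Pi.single e.2 1))⁻¹) = rectMagSum (Ls := Ls) ρ b := by
  unfold rectMagSum
  refine Finset.sum_congr rfl fun x _ => Finset.sum_congr rfl fun p _ => ?_
  obtain ⟨⟨i, j⟩, hij⟩ := p
  dsimp only
  have hc : x + Pi.single i 1 + Pi.single j 1 = x + Pi.single j 1 + Pi.single i 1 := by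
    rw [add_assoc, add_assoc]
    congr 1
    exact add_comm _ _
  have h : γ x * b (x, i) * (γ (x + Pi.single i 1))⁻¹ *
        (γ (x + Pi.single i 1) * b (x + Pi.single i 1, j) * (γ (x + Pi.single i 1 + Pi.single j 1))⁻¹) *
        (γ (x + Pi.single j 1) * b (x + Pi.single j 1, i) * (γ (x + Pi.single j 1 + Pi.single i 1))⁻¹)⁻¹ *
        (γ x * b (x, j) * (γ (x + Pi.single j 1))⁻¹)⁻¹ =
      γ x * (b (x, i) * b (x + Pi.single i 1, j) * (b (x + Pi.single j 1, i))⁻¹ * (b (x, j))⁻¹) * (γ x)⁻¹ := by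
    rw [hc]
    group
  rw [h, map_mul, map_mul, Matrix.trace_mul_cycle, ← map_mul, inv_mul_cancel, map_one, one_mul]

/-- A gauge transformation of the LATER slice is a right translation of the temporal links:
`rectElecSum(a, E, b^γ) = rectElecSum(a, E·γ, b)`. [folklore] -/
theorem rectElecSum_gauge_right (γ : RectTorusSite Ls → G) (a b : RectSlice Ls G) (E : RectTorusSite Ls → G) :
    rectElecSum (Ls := Ls) ρ a E (fun e => γ e.1 * b e * (γ (e.1 + Pi.single e.2 1))⁻¹) =
      rectElecSum (Ls := Ls) ρ a (E * γ) b := by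
  unfold rectElecSum
  refine Finset.sum_congr rfl fun x _ => Finset.sum_congr rfl fun i _ => ?_
  simp only [Pi.mul_apply, mul_inv_rev, mul_assoc]

/-- The un-averaged temporal weight at `E = 1` is the product of the one-link Wilson weights. [folklore] -/
theorem exp_rectElecSum_one_eq_prod (J : ℝ) (a b : RectSlice Ls G) :
    Real.exp (J * rectElecSum (Ls := Ls) ρ a 1 b) =
      ∏ e : RectTorusSite Ls × Fin k, Real.exp (J * (ρ (b e * (a e)⁻¹)).trace.re) := by
  unfold rectElecSum
  simp only [Pi.one_apply, inv_one, one_mul, mul_one, Finset.mul_sum, Real.exp_sum]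
  rw [← Finset.prod_product', ← Finset.univ_product_univ]

end Gauge

/-! ### Algebra of the straight Polyakov line `t ↦ (t ê_μ, μ)` on the rectangular torus -/

section LineAlgebra

variable {G : Type*} [Group G] {k : ℕ} {Ls : Fin k → ℕ} [∀ i, NeZero (Ls i)]

omit [∀ i, NeZero (Ls i)] in
/-- The shifted base point of the `t`-th line link is the base point of the `(t+1)`-st. [folklore] -/
theorem rectLineSite_shift (μ : Fin k) (t : ℕ) :
    (Pi.single μ ((t : ℕ) : ZMod (Ls μ)) : RectTorusSite Ls) + Pi.single μ 1 =
      Pi.single μ (((t + 1 : ℕ) : ℕ) : ZMod (Ls μ)) := by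
  rw [← Pi.single_add, Nat.cast_add, Nat.cast_one]

omit [∀ i, NeZero (Ls i)] in
/-- **A gauge transformation conjugates the line holonomy** (`(Ls μ) ê_μ = 0`). [folklore] -/
theorem prod_ofFn_rectLine_gauge (μ : Fin k) (γ : RectTorusSite Ls → G) (a : RectSlice Ls G) :
    (List.ofFn fun t : Fin (Ls μ) => (fun e : RectTorusSite Ls × Fin k => γ e.1 * a e * (γ (e.1 + Pi.single e.2 1))⁻¹)
        (Pi.single μ ((t : ℕ) : ZMod (Ls μ)), μ)).prod =
      γ 0 * (List.ofFn fun t : Fin (Ls μ) => a (Pi.single μ ((t : ℕ) : ZMod (Ls μ)), μ)).prod * (γ 0)⁻¹ := by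
  have h := prod_ofFn_telescope (Ls μ) (fun t => γ (Pi.single μ ((t : ℕ) : ZMod (Ls μ))))
    (fun t => a (Pi.single μ ((t : ℕ) : ZMod (Ls μ)), μ))
  simp only [rectLineSite_shift]
  rw [h]
  simp only [Nat.cast_zero, Pi.single_zero, ZMod.natCast_self]

omit [∀ i, NeZero (Ls i)] in
/-- On the line, the twist prefactor is `z` exactly on the link `t = 0` of a twisted direction. [folklore] -/
theorem rectFluxTwistPrefactor_line (z : G) (s : Fin k → ZMod 2) (μ : Fin k) (t : Fin (Ls μ)) :
    rectFluxTwistPrefactor (Ls := Ls) z s (Pi.single μ ((t : ℕ) : ZMod (Ls μ)), μ) =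
      if s μ = 1 ∧ (t : ℕ) = 0 then z else 1 := by
  unfold rectFluxTwistPrefactor
  simp only [Pi.single_eq_same]
  have h : (((t : ℕ) : ZMod (Ls μ)) = 0) ↔ (t : ℕ) = 0 := by
    rw [ZMod.natCast_eq_zero_iff]
    exact ⟨fun hd => Nat.eq_zero_of_dvd_of_lt hd t.2, fun h0 => by rw [h0]; exact dvd_zero _⟩
  simp only [h]

/-- A prefactor that is `z` only on the first entry of an ordered product pulls out:
`∏ₜ (z^{[c ∧ t = 0]} fₜ) = z^{[c]} ∏ₜ fₜ`. [folklore] -/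
theorem prod_ofFn_ite_zero_mul (N : ℕ) [NeZero N] (z : G) (c : Prop) [Decidable c] (f : Fin N → G) :
    (List.ofFn fun t : Fin N => (if c ∧ (t : ℕ) = 0 then z else 1) * f t).prod =
      (if c then z else 1) * (List.ofFn f).prod := by
  obtain ⟨m, rfl⟩ := Nat.exists_eq_succ_of_ne_zero (NeZero.ne N)
  rw [List.ofFn_succ, List.prod_cons, List.ofFn_succ, List.prod_cons]
  have htail : (fun i : Fin m => (if c ∧ ((i.succ : Fin (m + 1)) : ℕ) = 0 then z else 1) * f i.succ) =
      fun i : Fin m => f i.succ := by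
    funext i
    simp only [Fin.val_succ, Nat.add_eq_zero_iff, one_ne_zero, and_false, if_false, one_mul]
  rw [htail]
  simp only [Fin.val_zero, and_true, mul_assoc]

/-- **The centre twist multiplies the line holonomy by one factor `z`** iff the line's direction is twisted.
[cite: tHooft1979Flux] -/
theorem prod_ofFn_rectLine_fluxTwist (z : G) (s : Fin k → ZMod 2) (μ : Fin k) (a : RectSlice Ls G) :
    (List.ofFn fun t : Fin (Ls μ) => rectFluxTwist z s a (Pi.single μ ((t : ℕ) : ZMod (Ls μ)), μ)).prod =
      (if s μ = 1 then z else 1) * (List.ofFn fun t : Fin (Ls μ) => a (Pi.single μ ((t : ℕ) : ZMod (Ls μ)), μ)).prod := by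
  simp only [rectFluxTwist_apply, rectFluxTwistPrefactor_line]
  exact prod_ofFn_ite_zero_mul (Ls μ) z (s μ = 1) _

end LineAlgebra

/-! ### Gauging away the temporal links against a gauge-invariant function (rectangular slice) -/

section Substitution

variable {G : Type*} [Group G] [TopologicalSpace G] [IsTopologicalGroup G] [CompactSpace G]
  [MeasurableSpace G] [BorelSpace G] [SecondCountableTopology G] {n k : ℕ} (ρ : G →* Matrix (Fin n) (Fin n) ℂ)
  (J : ℝ) {Ls : Fin k → ℕ} [∀ i, NeZero (Ls i)]

/-- **Gauging away the temporal links** (rectangular slice): for a continuous gauge-invariant `F`,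
`∫ e^{J elec(a,E,b)} F(b) db = ∫ e^{J elec(a,1,b)} F(b) db`. [cite: MontvayMunster1994, §3.2.6] -/
theorem integral_exp_rectElecSum_mul_eq_one (hρ : Continuous ρ) {F : RectSlice Ls G → ℝ} (hF : Continuous F)
    (hFg : ∀ (γ : RectTorusSite Ls → G) (b : RectSlice Ls G),
      F (fun e => γ e.1 * b e * (γ (e.1 + Pi.single e.2 1))⁻¹) = F b)
    (a : RectSlice Ls G) (E : RectTorusSite Ls → G) :
    ∫ b, Real.exp (J * rectElecSum (Ls := Ls) ρ a E b) * F b ∂(rectSliceMeasure G Ls) =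
      ∫ b, Real.exp (J * rectElecSum (Ls := Ls) ρ a 1 b) * F b ∂(rectSliceMeasure G Ls) := by
  have hmp := measurePreserving_rectGauge (G := G) (Ls := Ls) E
  set g : RectSlice Ls G → ℝ := fun b => Real.exp (J * rectElecSum (Ls := Ls) ρ a 1 b) * F b with hg
  have hgc : Continuous g := by
    have he : Continuous fun b : RectSlice Ls G => rectElecSum (Ls := Ls) ρ a 1 b :=
      Continuous.comp (g := fun q : RectSlice Ls G × (RectTorusSite Ls → G) × RectSlice Ls G =>
          rectElecSum (Ls := Ls) ρ q.1 q.2.1 q.2.2) (f := fun b => (a, (1 : RectTorusSite Ls → G), b))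
        (continuous_rectElecSum_triple ρ hρ) (continuous_const.prodMk (continuous_const.prodMk continuous_id))
    exact (Real.continuous_exp.comp (continuous_const.mul he)).mul hF
  have h1 : (fun b => Real.exp (J * rectElecSum (Ls := Ls) ρ a E b) * F b) =
      g ∘ fun (b : RectSlice Ls G) (e : RectTorusSite Ls × Fin k) => E e.1 * b e * (E (e.1 + Pi.single e.2 1))⁻¹ := by
    funext b
    simp only [hg, comp_apply]
    rw [rectElecSum_gauge_right, one_mul, hFg]
  rw [h1]
  have hg' : AEStronglyMeasurable g (Measure.map
      (fun (b : RectSlice Ls G) (e : RectTorusSite Ls × Fin k) => E e.1 * b e * (E (e.1 + Pi.single e.2 1))⁻¹)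
      (rectSliceMeasure G Ls)) := by
    rw [hmp.map_eq]; exact hgc.aestronglyMeasurable
  have h2 := integral_map hmp.measurable.aemeasurable hg'
  rw [hmp.map_eq] at h2
  exact h2.symm

omit [SecondCountableTopology G] in
/-- **Shifting the later slice by the earlier one** (rectangular slice):
`∫ (∏_e w(b_e a_e⁻¹)) F(b) db = ∫ (∏_e w(c_e)) F(c·a) dc`. [folklore] -/
theorem integral_prod_weight_shift_rect (w : G → ℝ) (F : RectSlice Ls G → ℝ) (a : RectSlice Ls G) :
    ∫ b, (∏ e : RectTorusSite Ls × Fin k, w (b e * (a e)⁻¹)) * F b ∂(rectSliceMeasure G Ls) =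
      ∫ c, (∏ e : RectTorusSite Ls × Fin k, w (c e)) * F (c * a) ∂(rectSliceMeasure G Ls) := by
  have hmp : MeasurePreserving (fun c : RectSlice Ls G => fun e => c e * a e) (rectSliceMeasure G Ls)
      (rectSliceMeasure G Ls) :=
    measurePreserving_pi (f := fun (e : RectTorusSite Ls × Fin k) (x : G) => x * a e) (fun _ => haarProbability G)
      (fun _ => haarProbability G) fun e => measurePreserving_mul_right (haarProbability G) (a e)
  have hemb : MeasurableEmbedding (fun c : RectSlice Ls G => fun e => c e * a e) :=
    (MeasurableEquiv.piCongrRight fun e : RectTorusSite Ls × Fin k => MeasurableEquiv.mulRight (a e)).measurableEmbedding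
  rw [← hmp.integral_comp hemb]
  refine integral_congr_ae (Eventually.of_forall fun c => ?_)
  simp only [mul_inv_cancel_right]
  rfl

/-- **The temporal-link integral against a gauge-invariant function is a link-wise convolution** (rectangular
slice): `∫ (∫ e^{J elec(a,E,b)} dE) F(b) db = ∫ (∏_e e^{J Re tr ρ(c_e)}) F(c·a) dc`. [cite: MontvayMunster1994, §3.2.6] -/
theorem integral_integral_exp_rectElecSum_mul (hρ : Continuous ρ) {F : RectSlice Ls G → ℝ} (hF : Continuous F)
    (hFg : ∀ (γ : RectTorusSite Ls → G) (b : RectSlice Ls G),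
      F (fun e => γ e.1 * b e * (γ (e.1 + Pi.single e.2 1))⁻¹) = F b)
    (a : RectSlice Ls G) :
    ∫ b, (∫ E, Real.exp (J * rectElecSum (Ls := Ls) ρ a E b)
        ∂(Measure.pi fun _ : RectTorusSite Ls => haarProbability G)) * F b ∂(rectSliceMeasure G Ls) =
      ∫ c, (∏ e : RectTorusSite Ls × Fin k, Real.exp (J * (ρ (c e)).trace.re)) * F (c * a)
        ∂(rectSliceMeasure G Ls) := by
  have hc : Continuous fun p : RectSlice Ls G × (RectTorusSite Ls → G) =>
      Real.exp (J * rectElecSum (Ls := Ls) ρ a p.2 p.1) * F p.1 := by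
    have he : Continuous fun p : RectSlice Ls G × (RectTorusSite Ls → G) => rectElecSum (Ls := Ls) ρ a p.2 p.1 :=
      Continuous.comp (g := fun q : RectSlice Ls G × (RectTorusSite Ls → G) × RectSlice Ls G =>
          rectElecSum (Ls := Ls) ρ q.1 q.2.1 q.2.2)
        (f := fun p : RectSlice Ls G × (RectTorusSite Ls → G) => (a, p.2, p.1))
        (continuous_rectElecSum_triple ρ hρ) (continuous_const.prodMk (continuous_snd.prodMk continuous_fst))
    exact (Real.continuous_exp.comp (continuous_const.mul he)).mul (hF.comp continuous_fst)
  have hint : Integrable (uncurry fun (b : RectSlice Ls G) (E : RectTorusSite Ls → G) =>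
      Real.exp (J * rectElecSum (Ls := Ls) ρ a E b) * F b)
      ((rectSliceMeasure G Ls).prod (Measure.pi fun _ : RectTorusSite Ls => haarProbability G)) :=
    hc.integrable_of_hasCompactSupport (HasCompactSupport.of_compactSpace _)
  simp_rw [← integral_mul_const]
  rw [integral_integral_swap hint]
  have h1 : ∀ E : RectTorusSite Ls → G,
      ∫ b, Real.exp (J * rectElecSum (Ls := Ls) ρ a E b) * F b ∂(rectSliceMeasure G Ls) =
      ∫ b, (∏ e : RectTorusSite Ls × Fin k, Real.exp (J * (ρ (b e * (a e)⁻¹)).trace.re)) * F b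
        ∂(rectSliceMeasure G Ls) := by
    intro E
    rw [integral_exp_rectElecSum_mul_eq_one ρ J hρ hF hFg a E]
    simp_rw [exp_rectElecSum_one_eq_prod ρ J a]
  simp_rw [h1]
  rw [integral_const, probReal_univ, one_smul]
  exact integral_prod_weight_shift_rect (fun g => Real.exp (J * (ρ g).trace.re)) F a

end Substitution

/-! ### The weighted rectangular-slice integral of a line trace: window lemma and Haar chain -/

section Line

variable {G : Type*} [Group G] [TopologicalSpace G] [IsTopologicalGroup G] [CompactSpace G]
  [MeasurableSpace G] [BorelSpace G] [SecondCountableTopology G] {n k : ℕ} (ρ : G →* Matrix (Fin n) (Fin n) ℂ)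
  {Ls : Fin k → ℕ} [∀ i, NeZero (Ls i)]

/-- **Links off the family integrate out, links on it form a Haar chain** (rectangular slice): for an injective
`ℓ : Fin m → links`, a continuous weight `w` with Schur scalar `λ` and `c₀ = ∫ w`,
`∫ (∏_e w(c_e)) Re tr(A ρ(∏ₜ c_{ℓ t} aₜ) B) dc = c₀^{N − m} λ^m Re tr(A ρ(∏ₜ aₜ) B)`. [folklore] -/
theorem integral_prod_weight_mul_re_trace_rectLine {w : G → ℝ} (hw : Continuous w) (hρ : Continuous ρ) {lam : ℝ}
    (hM : ∀ i j, ∫ c, (w c : ℂ) * ρ c i j ∂haarProbability G = if i = j then (lam : ℂ) else 0) {m : ℕ}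
    (ℓ : Fin m → RectTorusSite Ls × Fin k) (hℓ : Injective ℓ) (a : Fin m → G) (A B : Matrix (Fin n) (Fin n) ℂ) :
    ∫ c, (∏ e : RectTorusSite Ls × Fin k, w (c e)) * (A * ρ ((List.ofFn fun t => c (ℓ t) * a t).prod) * B).trace.re
        ∂(rectSliceMeasure G Ls) =
      (∫ g, w g ∂haarProbability G) ^ (Fintype.card (RectTorusSite Ls × Fin k) - m) * lam ^ m *
        (A * ρ ((List.ofFn a).prod) * B).trace.re := by
  classical
  set s : Set (RectTorusSite Ls × Fin k) := Set.range ℓ with hs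
  set e : Fin m ⊕ ↥sᶜ ≃ RectTorusSite Ls × Fin k :=
    (Equiv.sumCongr (Equiv.ofInjective ℓ hℓ) (Equiv.refl _)).trans (Equiv.Set.sumCompl s) with he
  have he1 : ∀ t : Fin m, e (Sum.inl t) = ℓ t := fun t => by
    simp [he, Equiv.Set.sumCompl_apply_inl]
  set f : (Fin m → G) → ℝ := fun y => (A * ρ ((List.ofFn fun t => y t * a t).prod) * B).trace.re with hf
  have h1 : (fun c : RectSlice Ls G => (∏ e : RectTorusSite Ls × Fin k, w (c e)) *
      (A * ρ ((List.ofFn fun t => c (ℓ t) * a t).prod) * B).trace.re) =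
      fun c => f (fun i => c (e (Sum.inl i))) * ∏ t : RectTorusSite Ls × Fin k, (fun _ : RectTorusSite Ls × Fin k => w) t (c t) := by
    funext c
    simp only [hf, he1, mul_comm]
  rw [h1, slab_integral_pi_window_one (haarProbability G) e (fun _ : RectTorusSite Ls × Fin k => w) f]
  have h2 : ∫ y : Fin m → G, f y * ∏ i, (fun _ : RectTorusSite Ls × Fin k => w) (e (Sum.inl i)) (y i)
      ∂(Measure.pi fun _ => haarProbability G) = lam ^ m * (A * ρ ((List.ofFn a).prod) * B).trace.re := by
    simp only [hf]
    simp_rw [mul_comm (( _ : Matrix (Fin n) (Fin n) ℂ).trace.re) (∏ i : Fin m, w _)]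
    exact integral_prod_mul_re_trace_chain ρ hw hρ hM m a A B
  rw [h2, Finset.prod_const, Finset.card_univ]
  have hcard : Fintype.card ↥sᶜ = Fintype.card (RectTorusSite Ls × Fin k) - m := by
    rw [Fintype.card_compl_set, Set.card_range_of_injective hℓ, Fintype.card_fin]
  rw [hcard]
  ring

end Line

end Summit.Ventures.YMGap.FlowData
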